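import Literature.NumberTheory.Automorphic.ArithmeticQuotientHeckeTwoLevel
import Literature.NumberTheory.Automorphic.HidaTowerLevels
import Literature.NumberTheory.Automorphic.TameLevelScalarFactorisation
import HarnessLib

/-!
# Hida's lemma for `GL₂`: `U_v` at Iwahori level `Iw_v(b, c+1)` factors through level `Iw_v(b, c)`

Topic `NumberTheory/Automorphic`; namespace `Literature.NumberTheory.Automorphic.BigHeckeGLn`
(`TameLevel`); theorems only.  Proof file supporting the named fact
`Literature.NumberTheory.Automorphic.hidaControl_dominantOrdinaryPoint` (Hida's control theorem):
the `GL₂` half of [KhareThorne2017, §6.2 Lemma 6.5 (3), §6.3 Lemma 6.10] ("Hida's lemma": the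
ordinary parts do not depend on the lower congruence exponent `c`), in the cohomological model of the
tree and in finiteness-free form, by verifying the two coset hypotheses of the generic factorisation
theorems of `ArithmeticQuotientHeckeTwoLevel` for the levels `levelAt` of `HidaTowerLevels`.

Let `U` be a tame level of `GL₂/K` maximal above `p`, `v ∣ p`, and `L = U^p × ∏_w Λ_w`,
`L' = U^p × ∏_w Λ'_w` two levels with the SAME factors off `v` and `Λ_v = Iw_v(b, c)`,
`Λ'_v = Iw_v(b, c + 1)` (`1 ≤ c`, `b ≤ c + 1`); `t = t_{v,1} = ι_v(diag(ϖ_v, 1))`.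

* `conj_cutDiag_mem_iwahoriLevel_succ` (local, `GL₂(K_v)`): if `m ∈ Iw_v(b,c)` and
  `t⁻¹ m t ∈ Iw_v(b,c)` then `t⁻¹ m t ∈ Iw_v(b, c+1)` — conjugation by `t` multiplies the bottom-left
  entry by `ϖ_v`.
* `levelAt_coset_eq_of_conj_mem` (hypothesis `hC₂` of the generic file: `Stab_L(tL) = Stab_L(tL')`)
  and `exists_levelAt_coset_eq` (hypothesis `hC₁`: `L t L' = L' t L'`, from the Iwahori
  factorisation `exists_unipotent_cutDiag_conj_mem`: `l_v = n⁺ · t m t⁻¹` with `n⁺` unipotent and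
  `m ∈ Iw_v(b, c+1)`).
* Consequently (`ArithmeticQuotientHeckeTwoLevel`), on every `H^i(X_•, M)` and for every coefficient
  module: **`res ∘ [L t L'] = U_v'`** (the operator `U_v` of level `L'` factors through `H^i(X_L, M)`,
  `heckeOperator₂_comp_cohomologyPullback_levelAt`) and **`[L t L'] ∘ res = U_v`**
  (`cohomologyPullback_comp_heckeOperator₂_levelAt`); hence `res` intertwines `U_v` and `U_v'`
  (`cohomologyPullback_comm_heckeOperator_levelAt`, [KhareThorne2017, Lemma 6.5 (2)]), the kernel of
  `res : H^i(X_L) → H^i(X_{L'})` is killed by `U_v` and the image of `U_v'` is contained in the image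
  of `res` — so that `res` is an isomorphism between the ordinary parts as soon as `U_v, U_v'` act
  bijectively on them (`bijOn_of_comp_eq`), which is [KhareThorne2017, Lemma 6.10] for finite
  coefficients.

## References

* C. Khare, J. A. Thorne, *Potential automorphy and the Leopoldt conjecture*, Amer. J. Math. 139
  (2017), §6.2 Lemma 6.5, §6.3 Lemma 6.10 (arXiv:1409.7007, held; read 2026-08-16). [KhareThorne2017]
* H. Hida, *p-adic ordinary Hecke algebras for GL(2)*, Ann. Inst. Fourier 44 (1994), §2 (held).
  [Hida1994AIF]
-/

noncomputable section

open scoped NumberField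
open IsDedekindDomain CategoryTheory

namespace Literature.NumberTheory.Automorphic.BigHeckeGLn

variable {K : Type} [Field K] [NumberField K]

/-! ### Local: conjugation by `t = diag(ϖ, 1)` deepens the Iwahori level -/

/-- In `Fin 2`, `j < i` forces `i = 1`, `j = 0`. [folklore] -/
private theorem fin_two_eq_of_lt {i j : Fin 2} (h : j < i) : i = 1 ∧ j = 0 := by
  omega

/-- `|ϖ_v|^c · |ϖ_v| = |ϖ_v|^{c+1}` in the value group. [folklore] -/
private theorem exp_neg_mul_exp_neg_one (c : ℕ) :
    (WithZero.exp (-(c : ℤ)) : WithZero (Multiplicative ℤ)) * WithZero.exp (-1 : ℤ) =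
      WithZero.exp (-((c + 1 : ℕ) : ℤ)) := by
  rw [← WithZero.exp_add]
  congr 1
  push_cast
  ring

/-- **Conjugation by `t = diag(ϖ_v, 1)` deepens the Iwahori level of `GL₂`.**  If
`m ∈ Iw_v(b, c)` and `t⁻¹ m t ∈ Iw_v(b, c)` (i.e. the top-right entry of `m` is divisible by `ϖ_v`),
then `t⁻¹ m t ∈ Iw_v(b, c + 1)` provided `b ≤ c + 1`: the bottom-left entry of `t⁻¹ m t` is `ϖ_v`
times that of `m`. [cite: KhareThorne2017, §6.2, Lemma 6.5 (3)] -/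
theorem conj_cutDiag_mem_iwahoriLevel_succ (v : HeightOneSpectrum (𝓞 K)) {b c : ℕ} (hbc : b ≤ c + 1)
    {m : GL (Fin 2) (v.adicCompletion K)} (hm : m ∈ iwahoriLevel 2 v b c)
    (hconj : (cutDiag (uniformizerAt v) 1)⁻¹ * m * cutDiag (uniformizerAt v) 1 ∈ iwahoriLevel 2 v b c) :
    (cutDiag (uniformizerAt v) 1)⁻¹ * m * cutDiag (uniformizerAt v) 1 ∈ iwahoriLevel 2 v b (c + 1) := by
  set t : GL (Fin 2) (v.adicCompletion K) := cutDiag (uniformizerAt v) 1 with ht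
  have hle : (WithZero.exp (-((c + 1 : ℕ) : ℤ)) : WithZero (Multiplicative ℤ)) ≤
      WithZero.exp (-(b : ℤ)) := WithZero.exp_le_exp.2 (by omega)
  have hmin : min (WithZero.exp (-(b : ℤ)) : WithZero (Multiplicative ℤ)) (WithZero.exp (-((c + 1 : ℕ) : ℤ))) =
      WithZero.exp (-((c + 1 : ℕ) : ℤ)) := min_eq_right hle
  -- the bottom-left entry of `t⁻¹ x t` for `x ∈ Iw_v(b, c)`
  have key : ∀ {x : GL (Fin 2) (v.adicCompletion K)},
      IwahoriCond (Fin 2) (WithZero.exp (-(b : ℤ)) : WithZero (Multiplicative ℤ)) (WithZero.exp (-(c : ℤ)))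
        (x : Matrix (Fin 2) (Fin 2) (v.adicCompletion K)) →
      IwahoriCond (Fin 2) (WithZero.exp (-(b : ℤ)) : WithZero (Multiplicative ℤ)) (WithZero.exp (-(c : ℤ)))
        ((t⁻¹ * x * t : GL (Fin 2) (v.adicCompletion K)) : Matrix (Fin 2) (Fin 2) (v.adicCompletion K)) →
      IwahoriCond (Fin 2) (WithZero.exp (-(b : ℤ)) : WithZero (Multiplicative ℤ))
        (WithZero.exp (-((c + 1 : ℕ) : ℤ)))
        ((t⁻¹ * x * t : GL (Fin 2) (v.adicCompletion K)) : Matrix (Fin 2) (Fin 2) (v.adicCompletion K)) := by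
    intro x hx hx'
    refine ⟨hx'.le_one, fun i j hij => ?_, hx'.diag⟩
    obtain ⟨rfl, rfl⟩ := fin_two_eq_of_lt hij
    rw [hmin, ht, valued_cutDiag_inv_mul_mul_apply]
    simp only [Fin.val_one, lt_self_iff_false, if_false, Fin.val_zero, Nat.lt_one_iff, if_true, one_mul]
    rw [valued_coe_uniformizerAt, ← exp_neg_mul_exp_neg_one]
    exact mul_le_mul_left ((hx.lower 1 0 (by decide)).trans (min_le_right _ _)) _
  refine ⟨key hm.1 hconj.1, ?_⟩
  have e : ((t⁻¹ * m * t)⁻¹ : GL (Fin 2) (v.adicCompletion K)) = t⁻¹ * m⁻¹ * t := by group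
  rw [e]
  have e' : ((t⁻¹ * m * t)⁻¹ : GL (Fin 2) (v.adicCompletion K)) = t⁻¹ * m⁻¹ * t := e
  have h2 := hconj.2
  rw [e'] at h2
  exact key hm.2 h2

/-- `|ϖ_v| ≤ 1`. [folklore] -/
private theorem valued_uniformizerAt_le_one' (v : HeightOneSpectrum (𝓞 K)) :
    Valued.v ((uniformizerAt v : (v.adicCompletion K)ˣ) : v.adicCompletion K) ≤ 1 := by
  rw [valued_coe_uniformizerAt, ← WithZero.exp_zero]
  exact WithZero.exp_le_exp.2 (by norm_num)


/-! ### Generic: intertwining maps preserve `⋂ₘ U^m H` -/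

section Intertwine

variable {R : Type*} [Semiring R] {V W : Type*} [AddCommMonoid V] [AddCommMonoid W] [Module R V]
  [Module R W]

/-- If `f ∘ U = U' ∘ f` then `f ∘ U^m = U'^m ∘ f`. [folklore] -/
theorem comp_pow_eq_pow_comp_of_comp_eq {f : V →ₗ[R] W} {U : Module.End R V} {U' : Module.End R W}
    (h : f ∘ₗ U = U' ∘ₗ f) (m : ℕ) : f ∘ₗ (U ^ m) = (U' ^ m) ∘ₗ f := by
  induction m with
  | zero => rw [pow_zero, pow_zero, Module.End.one_eq_id, Module.End.one_eq_id, LinearMap.comp_id,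
      LinearMap.id_comp]
  | succ m ih =>
    rw [pow_succ, pow_succ, Module.End.mul_eq_comp, Module.End.mul_eq_comp, ← LinearMap.comp_assoc, ih,
      LinearMap.comp_assoc, h, ← LinearMap.comp_assoc]

/-- **A map intertwining `U` and `U'` sends `⋂ₘ U^m V` into `⋂ₘ U'^m W`** (the finiteness-free
ordinary parts are functorial). [folklore] -/
theorem map_iInf_range_pow_le_of_comp_eq {f : V →ₗ[R] W} {U : Module.End R V} {U' : Module.End R W}
    (h : f ∘ₗ U = U' ∘ₗ f) :
    (⨅ m : ℕ, LinearMap.range (U ^ m)).map f ≤ ⨅ m : ℕ, LinearMap.range (U' ^ m) := by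
  refine le_iInf fun m => (Submodule.map_mono (iInf_le _ m)).trans ?_
  rintro _ ⟨v, hv, rfl⟩
  obtain ⟨w, rfl⟩ := LinearMap.mem_range.1 hv
  refine ⟨f w, ?_⟩
  have e := LinearMap.congr_fun (comp_pow_eq_pow_comp_of_comp_eq h m) w
  rw [LinearMap.comp_apply, LinearMap.comp_apply] at e
  exact e.symm

/-- Set-level form: `f` maps `⋂ₘ U^m V` into `⋂ₘ U'^m W`. [folklore] -/
theorem mapsTo_iInf_range_pow_of_comp_eq {f : V →ₗ[R] W} {U : Module.End R V} {U' : Module.End R W}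
    (h : f ∘ₗ U = U' ∘ₗ f) :
    Set.MapsTo f (⨅ m : ℕ, LinearMap.range (U ^ m) : Submodule R V)
      (⨅ m : ℕ, LinearMap.range (U' ^ m) : Submodule R W) :=
  fun _ hv => map_iInf_range_pow_le_of_comp_eq h ⟨_, hv, rfl⟩

end Intertwine

namespace TameLevel

variable {p : ℕ} [Fact p.Prime] (𝒰 : TameLevel 2 K p)

variable {Λ Λ' : ∀ v : {v : HeightOneSpectrum (𝓞 K) // (p : 𝓞 K) ∈ v.asIdeal},
  Subgroup (GL (Fin 2) (v.1.adicCompletion K))}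

/-! ### The two coset hypotheses for `L = levelAt Λ ≥ L' = levelAt Λ'`, `t = t_{v,1}` -/

section Cosets

variable {v : HeightOneSpectrum (𝓞 K)} (hv : (p : 𝓞 K) ∈ v.asIdeal) {b c : ℕ}
  (hΛv : Λ ⟨v, hv⟩ = iwahoriLevel 2 v b c) (hΛ'v : Λ' ⟨v, hv⟩ = iwahoriLevel 2 v b (c + 1))
  (hΛ' : ∀ w : {w : HeightOneSpectrum (𝓞 K) // (p : 𝓞 K) ∈ w.asIdeal}, w.1 ≠ v → Λ' w = Λ w)

include hΛv hΛ'v hΛ' in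
/-- `L' ≤ L` for the two levels (deeper Iwahori factor at `v`, same factors elsewhere). [folklore] -/
theorem levelAt_le_levelAt_of_succ : 𝒰.levelAt Λ' ≤ 𝒰.levelAt Λ := by
  refine 𝒰.levelAt_mono fun w => ?_
  by_cases hwv : w.1 = v
  · obtain ⟨w, hw⟩ := w
    dsimp only at hwv
    subst hwv
    rw [hΛv, hΛ'v]
    exact iwahoriLevel_antitone w le_rfl (Nat.le_succ c)
  · rw [hΛ' w hwv]

include hΛv hΛ'v hΛ' in
/-- **Hypothesis `hC₂` (stabilisers): for `l ∈ L` with `t⁻¹ l t ∈ L` one has `t⁻¹ l t ∈ L'`**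
(`b ≤ c + 1`), in the coset form used by `ArithmeticQuotientHeckeTwoLevel`. [folklore] -/
theorem levelAt_coset_eq_of_conj_mem (hbc : b ≤ c + 1) :
    ∀ l ∈ 𝒰.levelAt Λ,
      (((l * heckeElement 2 K v 1 : FiniteAdelicGL 2 K)) : FiniteAdelicGL 2 K ⧸ 𝒰.levelAt Λ) =
          (heckeElement 2 K v 1 : FiniteAdelicGL 2 K ⧸ 𝒰.levelAt Λ) →
        (((l * heckeElement 2 K v 1 : FiniteAdelicGL 2 K)) : FiniteAdelicGL 2 K ⧸ 𝒰.levelAt Λ') =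
          (heckeElement 2 K v 1 : FiniteAdelicGL 2 K ⧸ 𝒰.levelAt Λ') := by
  intro l hl he
  rw [QuotientGroup.eq] at he ⊢
  set y := (l * heckeElement 2 K v 1)⁻¹ * heckeElement 2 K v 1 with hy
  rw [mem_levelAt_iff] at he ⊢
  refine ⟨he.1, fun w hw => ?_⟩
  by_cases hwv : w = v
  · subst hwv
    rw [hΛ'v]
    have hyv : localComponent 2 K w y =
        (cutDiag (uniformizerAt w) 1)⁻¹ * (localComponent 2 K w l)⁻¹ * cutDiag (uniformizerAt w) 1 := by
      rw [hy, mul_inv_rev, map_mul, map_mul, map_inv, map_inv, localComponent_heckeElement_self]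
    have h1 := he.2 w hw
    rw [hyv, hΛv] at h1
    have hlv := ((𝒰.mem_levelAt_iff Λ l).1 hl).2 w hw
    rw [hΛv] at hlv
    rw [hyv]
    exact conj_cutDiag_mem_iwahoriLevel_succ w hbc (inv_mem hlv) h1
  · rw [hΛ' ⟨w, hw⟩ hwv]
    exact he.2 w hw

include hΛv hΛ'v hΛ' in
/-- **Hypothesis `hC₁` (`L t L' = L' t L'`): every `l t L'`, `l ∈ L`, equals `l' t L'` for some
`l' ∈ L'`** (`U` maximal above `p`, `1 ≤ c`, `b ≤ c + 1`).  By the Iwahori factorisation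
(`exists_unipotent_cutDiag_conj_mem`) `l_v = n⁺ m'` with `n⁺` unipotent upper triangular and
`t⁻¹ m' t ∈ Iw_v(b, c)`, hence `∈ Iw_v(b, c+1)`; take `l' = l ι_v(l_v)⁻¹ ι_v(n⁺)`.
[cite: KhareThorne2017, §6.2, Lemma 6.5 (3)] -/
theorem exists_levelAt_coset_eq (h𝒰 : 𝒰.IsMaximalAbove) (hc : 1 ≤ c) (hbc : b ≤ c + 1) :
    ∀ l ∈ 𝒰.levelAt Λ, ∃ l' ∈ 𝒰.levelAt Λ',
      (((l * heckeElement 2 K v 1 : FiniteAdelicGL 2 K)) : FiniteAdelicGL 2 K ⧸ 𝒰.levelAt Λ') =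
        ((l' * heckeElement 2 K v 1 : FiniteAdelicGL 2 K) : FiniteAdelicGL 2 K ⧸ 𝒰.levelAt Λ') := by
  intro l hl
  set A := localComponent 2 K v l with hA
  have hAmem : A ∈ iwahoriLevel 2 v b c := by
    have h := ((𝒰.mem_levelAt_iff Λ l).1 hl).2 v hv
    rwa [hΛv] at h
  have hγ : min (WithZero.exp (-(b : ℤ)) : WithZero (Multiplicative ℤ)) (WithZero.exp (-(c : ℤ))) ≤
      Valued.v ((uniformizerAt v : (v.adicCompletion K)ˣ) : v.adicCompletion K) := by
    rw [valued_coe_uniformizerAt]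
    exact (min_le_right _ _).trans (WithZero.exp_le_exp.2 (by omega))
  obtain ⟨u, hu, hm'⟩ := exists_unipotent_cutDiag_conj_mem (valued_uniformizerAt_le_one' v) hγ 1 hAmem
  set t : GL (Fin 2) (v.adicCompletion K) := cutDiag (uniformizerAt v) 1 with ht
  -- `m'' = t⁻¹ (u⁻¹ A) t ∈ Iw_v(b, c+1)`
  have hm'' : t⁻¹ * (u⁻¹ * A) * t ∈ iwahoriLevel 2 v b (c + 1) :=
    conj_cutDiag_mem_iwahoriLevel_succ v hbc (mul_mem (inv_mem (hu _ _)) hAmem) hm'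
  have hu₁ : u ∈ valuedCongruenceSubgroup (Fin 2) (1 : WithZero (Multiplicative ℤ)) :=
    valuedIwahoriSubgroup_le_valuedCongruenceSubgroup_one
      (hu (1 : WithZero (Multiplicative ℤ)) (1 : WithZero (Multiplicative ℤ)))
  refine ⟨l * (ofLocal 2 K v A)⁻¹ * ofLocal 2 K v u, ?_, ?_⟩
  · refine 𝒰.mul_ofLocal_inv_mul_ofLocal_mem_levelAt h𝒰 hv hl hu₁ ?_ fun w hw => (hΛ' w hw).symm.le
    rw [hΛ'v]
    exact hu _ _
  · rw [QuotientGroup.eq]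
    have e : (l * heckeElement 2 K v 1)⁻¹ * (l * (ofLocal 2 K v A)⁻¹ * ofLocal 2 K v u * heckeElement 2 K v 1) =
        (heckeElement 2 K v 1)⁻¹ * ((ofLocal 2 K v A)⁻¹ * ofLocal 2 K v u) * heckeElement 2 K v 1 := by
      group
    have e' : (heckeElement 2 K v 1)⁻¹ * ((ofLocal 2 K v A)⁻¹ * ofLocal 2 K v u) * heckeElement 2 K v 1 =
        ofLocal 2 K v ((t⁻¹ * (u⁻¹ * A) * t)⁻¹) := by
      rw [heckeElement_eq_ofLocal_cutDiag, ← ht]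
      simp only [← map_inv, ← map_mul]
      congr 1
      group
    rw [e, e']
    refine 𝒰.ofLocal_mem_levelAt h𝒰 hv (valuedIwahoriSubgroup_le_valuedCongruenceSubgroup_one
      (inv_mem hm'')) ?_
    rw [hΛ'v]
    exact inv_mem hm''

end Cosets

/-! ### Hida's lemma for the levels of `GL₂` -/

section HidaLemma

variable {v : HeightOneSpectrum (𝓞 K)} (hv : (p : 𝓞 K) ∈ v.asIdeal) {b c : ℕ}
  (hΛv : Λ ⟨v, hv⟩ = iwahoriLevel 2 v b c) (hΛ'v : Λ' ⟨v, hv⟩ = iwahoriLevel 2 v b (c + 1))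
  (hΛ' : ∀ w : {w : HeightOneSpectrum (𝓞 K) // (p : 𝓞 K) ∈ w.asIdeal}, w.1 ≠ v → Λ' w = Λ w)
  (k : Type) [CommRing k] (M : Type) [AddCommGroup M] [Module k M]

include hΛv hΛ'v hΛ' in
/-- **`U_v` at level `L'` factors through `H^i(X_L, M)`: `[L t L'] ≫ res = U_v'`** — the `GL₂` case
of [KhareThorne2017, Lemma 6.5 (3)] in the tree's cohomological model (`U` maximal above `p`,
`Λ_v = Iw_v(b,c)`, `Λ'_v = Iw_v(b,c+1)`, `1 ≤ c`, `b ≤ c+1`, `t = t_{v,1}`).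
[cite: KhareThorne2017, §6.2, Lemma 6.5 (3)] -/
theorem heckeOperator₂_comp_cohomologyPullback_levelAt (h𝒰 : 𝒰.IsMaximalAbove) (hc : 1 ≤ c)
    (hbc : b ≤ c + 1) (i : ℕ) :
    ArithmeticQuotient.heckeOperator₂ k (𝒰.levelAt Λ) (𝒰.levelAt Λ') (heckeElement 2 K v 1) M
        (globalEmbedding 2 K) i ≫
      ArithmeticQuotient.cohomologyPullback k (globalEmbedding 2 K) M
        (𝒰.levelAt_le_levelAt_of_succ hv hΛv hΛ'v hΛ') i =
      ArithmeticQuotient.heckeOperator k (𝒰.levelAt Λ') (heckeElement 2 K v 1) M (globalEmbedding 2 K) i :=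
  ArithmeticQuotient.heckeOperator₂_comp_cohomologyPullback k _ M _ _
    (𝒰.exists_levelAt_coset_eq hv hΛv hΛ'v hΛ' h𝒰 hc hbc) i

include hΛv hΛ'v hΛ' in
/-- **`U_v` at level `L` factors through `H^i(X_{L'}, M)`: `res ≫ [L t L'] = U_v`** (`b ≤ c + 1`).
[cite: KhareThorne2017, §6.3, Lemma 6.10 (proof)] -/
theorem cohomologyPullback_comp_heckeOperator₂_levelAt (hbc : b ≤ c + 1) (i : ℕ) :
    ArithmeticQuotient.cohomologyPullback k (globalEmbedding 2 K) M
        (𝒰.levelAt_le_levelAt_of_succ hv hΛv hΛ'v hΛ') i ≫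
      ArithmeticQuotient.heckeOperator₂ k (𝒰.levelAt Λ) (𝒰.levelAt Λ') (heckeElement 2 K v 1) M
        (globalEmbedding 2 K) i =
      ArithmeticQuotient.heckeOperator k (𝒰.levelAt Λ) (heckeElement 2 K v 1) M (globalEmbedding 2 K) i :=
  ArithmeticQuotient.cohomologyPullback_comp_heckeOperator₂ k _ M _ _
    (𝒰.levelAt_coset_eq_of_conj_mem hv hΛv hΛ'v hΛ' hbc) i

include hΛv hΛ'v hΛ' in
/-- **The pull-back `H^i(X_L, M) → H^i(X_{L'}, M)` intertwines `U_v` at the two levels**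
(`res ∘ U_v = U_v' ∘ res`) — [KhareThorne2017, Lemma 6.5 (2)] for this pair of levels.
[cite: KhareThorne2017, §6.2, Lemma 6.5 (2)] -/
theorem heckeOperator_comp_cohomologyPullback_levelAt (h𝒰 : 𝒰.IsMaximalAbove) (hc : 1 ≤ c)
    (hbc : b ≤ c + 1) (i : ℕ) :
    ArithmeticQuotient.heckeOperator k (𝒰.levelAt Λ) (heckeElement 2 K v 1) M (globalEmbedding 2 K) i ≫
      ArithmeticQuotient.cohomologyPullback k (globalEmbedding 2 K) M
        (𝒰.levelAt_le_levelAt_of_succ hv hΛv hΛ'v hΛ') i =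
      ArithmeticQuotient.cohomologyPullback k (globalEmbedding 2 K) M
        (𝒰.levelAt_le_levelAt_of_succ hv hΛv hΛ'v hΛ') i ≫
      ArithmeticQuotient.heckeOperator k (𝒰.levelAt Λ') (heckeElement 2 K v 1) M (globalEmbedding 2 K) i := by
  rw [← 𝒰.cohomologyPullback_comp_heckeOperator₂_levelAt hv hΛv hΛ'v hΛ' k M hbc i, Category.assoc,
    𝒰.heckeOperator₂_comp_cohomologyPullback_levelAt hv hΛv hΛ'v hΛ' k M h𝒰 hc hbc i]

include hΛv hΛ'v hΛ' in
/-- **The two-level operator intertwines `U_v'` and `U_v`: `U_v' ≫ [L t L'] = [L t L'] ≫ U_v`.**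
[folklore] -/
theorem heckeOperator_comp_heckeOperator₂_levelAt (h𝒰 : 𝒰.IsMaximalAbove) (hc : 1 ≤ c)
    (hbc : b ≤ c + 1) (i : ℕ) :
    ArithmeticQuotient.heckeOperator k (𝒰.levelAt Λ') (heckeElement 2 K v 1) M (globalEmbedding 2 K) i ≫
      ArithmeticQuotient.heckeOperator₂ k (𝒰.levelAt Λ) (𝒰.levelAt Λ') (heckeElement 2 K v 1) M
        (globalEmbedding 2 K) i =
      ArithmeticQuotient.heckeOperator₂ k (𝒰.levelAt Λ) (𝒰.levelAt Λ') (heckeElement 2 K v 1) M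
        (globalEmbedding 2 K) i ≫
      ArithmeticQuotient.heckeOperator k (𝒰.levelAt Λ) (heckeElement 2 K v 1) M (globalEmbedding 2 K) i := by
  rw [← 𝒰.heckeOperator₂_comp_cohomologyPullback_levelAt hv hΛv hΛ'v hΛ' k M h𝒰 hc hbc i, Category.assoc,
    𝒰.cohomologyPullback_comp_heckeOperator₂_levelAt hv hΛv hΛ'v hΛ' k M hbc i]

include hΛv hΛ'v hΛ' in
/-- **`res` maps `⋂ₘ U_v^m H^i(X_L, M)` into `⋂ₘ U_v'^m H^i(X_{L'}, M)`.** [folklore] -/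
theorem mapsTo_cohomologyPullback_iInf_range_levelAt (h𝒰 : 𝒰.IsMaximalAbove) (hc : 1 ≤ c)
    (hbc : b ≤ c + 1) (i : ℕ) :
    Set.MapsTo (ArithmeticQuotient.cohomologyPullback k (globalEmbedding 2 K) M
        (𝒰.levelAt_le_levelAt_of_succ hv hΛv hΛ'v hΛ') i).hom
      (⨅ m : ℕ, LinearMap.range (ArithmeticQuotient.heckeEnd k (𝒰.levelAt Λ) (heckeElement 2 K v 1) M
        (globalEmbedding 2 K) i ^ m) : Submodule k _)
      (⨅ m : ℕ, LinearMap.range (ArithmeticQuotient.heckeEnd k (𝒰.levelAt Λ') (heckeElement 2 K v 1) M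
        (globalEmbedding 2 K) i ^ m) : Submodule k _) := by
  refine mapsTo_iInf_range_pow_of_comp_eq ?_
  have h := congrArg ModuleCat.Hom.hom
    (𝒰.heckeOperator_comp_cohomologyPullback_levelAt hv hΛv hΛ'v hΛ' k M h𝒰 hc hbc i)
  rw [ModuleCat.hom_comp, ModuleCat.hom_comp] at h
  exact h

include hΛv hΛ'v hΛ' in
/-- **`[L t L']` maps `⋂ₘ U_v'^m H^i(X_{L'}, M)` into `⋂ₘ U_v^m H^i(X_L, M)`.** [folklore] -/
theorem mapsTo_heckeOperator₂_iInf_range_levelAt (h𝒰 : 𝒰.IsMaximalAbove) (hc : 1 ≤ c)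
    (hbc : b ≤ c + 1) (i : ℕ) :
    Set.MapsTo (ArithmeticQuotient.heckeOperator₂ k (𝒰.levelAt Λ) (𝒰.levelAt Λ')
        (heckeElement 2 K v 1) M (globalEmbedding 2 K) i).hom
      (⨅ m : ℕ, LinearMap.range (ArithmeticQuotient.heckeEnd k (𝒰.levelAt Λ') (heckeElement 2 K v 1) M
        (globalEmbedding 2 K) i ^ m) : Submodule k _)
      (⨅ m : ℕ, LinearMap.range (ArithmeticQuotient.heckeEnd k (𝒰.levelAt Λ) (heckeElement 2 K v 1) M
        (globalEmbedding 2 K) i ^ m) : Submodule k _) := by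
  refine mapsTo_iInf_range_pow_of_comp_eq ?_
  have h := congrArg ModuleCat.Hom.hom
    (𝒰.heckeOperator_comp_heckeOperator₂_levelAt hv hΛv hΛ'v hΛ' k M h𝒰 hc hbc i)
  rw [ModuleCat.hom_comp, ModuleCat.hom_comp] at h
  exact h

include hΛv hΛ'v hΛ' in
/-- **The kernel of `res : H^i(X_L, M) → H^i(X_{L'}, M)` is killed by `U_v`.** [folklore] -/
theorem ker_cohomologyPullback_le_ker_heckeEnd_levelAt (hbc : b ≤ c + 1) (i : ℕ) :
    LinearMap.ker (ArithmeticQuotient.cohomologyPullback k (globalEmbedding 2 K) M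
        (𝒰.levelAt_le_levelAt_of_succ hv hΛv hΛ'v hΛ') i).hom ≤
      LinearMap.ker (ArithmeticQuotient.heckeEnd k (𝒰.levelAt Λ) (heckeElement 2 K v 1) M
        (globalEmbedding 2 K) i) := by
  have h := congrArg ModuleCat.Hom.hom
    (𝒰.cohomologyPullback_comp_heckeOperator₂_levelAt hv hΛv hΛ'v hΛ' k M hbc i)
  rw [ModuleCat.hom_comp] at h
  exact ker_le_ker_of_comp_eq h

include hΛv hΛ'v hΛ' in
/-- **The image of `U_v'` on `H^i(X_{L'}, M)` lies in the image of `res`.** [folklore] -/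
theorem range_heckeEnd_le_range_cohomologyPullback_levelAt (h𝒰 : 𝒰.IsMaximalAbove) (hc : 1 ≤ c)
    (hbc : b ≤ c + 1) (i : ℕ) :
    LinearMap.range (ArithmeticQuotient.heckeEnd k (𝒰.levelAt Λ') (heckeElement 2 K v 1) M
        (globalEmbedding 2 K) i) ≤
      LinearMap.range (ArithmeticQuotient.cohomologyPullback k (globalEmbedding 2 K) M
        (𝒰.levelAt_le_levelAt_of_succ hv hΛv hΛ'v hΛ') i).hom := by
  have h := congrArg ModuleCat.Hom.hom
    (𝒰.heckeOperator₂_comp_cohomologyPullback_levelAt hv hΛv hΛ'v hΛ' k M h𝒰 hc hbc i)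
  rw [ModuleCat.hom_comp] at h
  exact range_le_range_of_comp_eq h

include hΛv hΛ'v hΛ' in
/-- **Hida's lemma for `GL₂` (finiteness-free form).**  For subspaces `V₀ ⊆ H^i(X_L, M)`,
`W₀ ⊆ H^i(X_{L'}, M)` exchanged by `res` and `[L t L']` on which `U_v` is injective resp. `U_v'` is
surjective (e.g. the ordinary parts of finite coefficient modules), `res : V₀ → W₀` is a bijection.
[cite: KhareThorne2017, §6.3, Lemma 6.10] -/
theorem bijOn_cohomologyPullback_levelAt (h𝒰 : 𝒰.IsMaximalAbove) (hc : 1 ≤ c) (hbc : b ≤ c + 1)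
    (i : ℕ) {V₀ : Set (ArithmeticQuotient.cohomology k (globalEmbedding 2 K) (𝒰.levelAt Λ) M i)}
    {W₀ : Set (ArithmeticQuotient.cohomology k (globalEmbedding 2 K) (𝒰.levelAt Λ') M i)}
    (hres : Set.MapsTo (ArithmeticQuotient.cohomologyPullback k (globalEmbedding 2 K) M
        (𝒰.levelAt_le_levelAt_of_succ hv hΛv hΛ'v hΛ') i).hom V₀ W₀)
    (hT : Set.MapsTo (ArithmeticQuotient.heckeOperator₂ k (𝒰.levelAt Λ) (𝒰.levelAt Λ')
        (heckeElement 2 K v 1) M (globalEmbedding 2 K) i).hom W₀ V₀)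
    (hU : Set.InjOn (ArithmeticQuotient.heckeEnd k (𝒰.levelAt Λ) (heckeElement 2 K v 1) M
        (globalEmbedding 2 K) i) V₀)
    (hU' : Set.SurjOn (ArithmeticQuotient.heckeEnd k (𝒰.levelAt Λ') (heckeElement 2 K v 1) M
        (globalEmbedding 2 K) i) W₀ W₀) :
    Set.BijOn (ArithmeticQuotient.cohomologyPullback k (globalEmbedding 2 K) M
        (𝒰.levelAt_le_levelAt_of_succ hv hΛv hΛ'v hΛ') i).hom V₀ W₀ := by
  have h₁ := congrArg ModuleCat.Hom.hom
    (𝒰.cohomologyPullback_comp_heckeOperator₂_levelAt hv hΛv hΛ'v hΛ' k M hbc i)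
  have h₂ := congrArg ModuleCat.Hom.hom
    (𝒰.heckeOperator₂_comp_cohomologyPullback_levelAt hv hΛv hΛ'v hΛ' k M h𝒰 hc hbc i)
  rw [ModuleCat.hom_comp] at h₁ h₂
  exact bijOn_of_comp_eq h₁ h₂ hres hT hU hU'

include hΛv hΛ'v hΛ' in
/-- **Hida's lemma for `GL₂` on `⋂ₘ U_v^m H`.**  If `U_v` is injective on `⋂ₘ U_v^m H^i(X_L, M)` and
`U_v'` maps `⋂ₘ U_v'^m H^i(X_{L'}, M)` onto itself (both automatic when these modules are finite), the
pull-back restricts to a bijection between them. [cite: KhareThorne2017, §6.3, Lemma 6.10] -/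
theorem bijOn_cohomologyPullback_iInf_range_levelAt (h𝒰 : 𝒰.IsMaximalAbove) (hc : 1 ≤ c)
    (hbc : b ≤ c + 1) (i : ℕ)
    (hU : Set.InjOn (ArithmeticQuotient.heckeEnd k (𝒰.levelAt Λ) (heckeElement 2 K v 1) M
        (globalEmbedding 2 K) i)
      (⨅ m : ℕ, LinearMap.range (ArithmeticQuotient.heckeEnd k (𝒰.levelAt Λ) (heckeElement 2 K v 1) M
        (globalEmbedding 2 K) i ^ m) : Submodule k _))
    (hU' : Set.SurjOn (ArithmeticQuotient.heckeEnd k (𝒰.levelAt Λ') (heckeElement 2 K v 1) M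
        (globalEmbedding 2 K) i)
      (⨅ m : ℕ, LinearMap.range (ArithmeticQuotient.heckeEnd k (𝒰.levelAt Λ') (heckeElement 2 K v 1) M
        (globalEmbedding 2 K) i ^ m) : Submodule k _)
      (⨅ m : ℕ, LinearMap.range (ArithmeticQuotient.heckeEnd k (𝒰.levelAt Λ') (heckeElement 2 K v 1) M
        (globalEmbedding 2 K) i ^ m) : Submodule k _)) :
    Set.BijOn (ArithmeticQuotient.cohomologyPullback k (globalEmbedding 2 K) M
        (𝒰.levelAt_le_levelAt_of_succ hv hΛv hΛ'v hΛ') i).hom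
      (⨅ m : ℕ, LinearMap.range (ArithmeticQuotient.heckeEnd k (𝒰.levelAt Λ) (heckeElement 2 K v 1) M
        (globalEmbedding 2 K) i ^ m) : Submodule k _)
      (⨅ m : ℕ, LinearMap.range (ArithmeticQuotient.heckeEnd k (𝒰.levelAt Λ') (heckeElement 2 K v 1) M
        (globalEmbedding 2 K) i ^ m) : Submodule k _) :=
  𝒰.bijOn_cohomologyPullback_levelAt hv hΛv hΛ'v hΛ' k M h𝒰 hc hbc i
    (𝒰.mapsTo_cohomologyPullback_iInf_range_levelAt hv hΛv hΛ'v hΛ' k M h𝒰 hc hbc i)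
    (𝒰.mapsTo_heckeOperator₂_iInf_range_levelAt hv hΛv hΛ'v hΛ' k M h𝒰 hc hbc i) hU hU'

end HidaLemma

end TameLevel

end Literature.NumberTheory.Automorphic.BigHeckeGLn
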